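import Literature.NumberTheory.ConnesConsani2021.QuasiInnerBlaschkeProduct
import HarnessLib

/-!
# Connes–Consani 2021 (JNT 226), Prop. 3.7 (ii): `ker((1 − 𝒫)ρ(u_p)𝒫) ∩ H² = B_p H²`

LABEL: RH-FREE (unconditional function theory on the circle; `bears_on: W-C/W-P` — infrastructure for the
typed fact `QuasiInner.prop_3_7`). WHAT THIS IS NOT: no statement about zeros of `ζ`, no spectral realization,
nothing here bears on the truth of RH.

Contents (theorems only; no new definitions, no new named facts):
* §D `B_p` on the circle (using the convergence theory of `QuasiInnerBlaschkeProduct`, seat t2 g4): the finite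
  products `B_N = ∏_{|n|≤N} b_{x_p(n)}` converge to `B_p` almost everywhere on `S¹`, `|B_p| = 1` a.e., and
  `B_p|_{S¹}`, `B̄_p|_{S¹} ∈ L^∞(S¹)`.
* §E `prop_3_7_ii`: `ker((1 − 𝒫)ρ(u_p)𝒫) ∩ H² = B_p · H²` (the zero-set description of the kernel from
  `QuasiInnerBlaschkeKernel`, F. Riesz division by the `B_N` from `QuasiInnerBlaschkeDivision`, then `N → ∞`
  by dominated convergence in the weak form `⟨φ | B_N h⟩ → ⟨φ | B_p h⟩`).

## References
* [CC21] A. Connes, C. Consani, *Quasi-inner functions and local factors*, J. Number Theory 226 (2021),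
  arXiv:2008.10974 — §3, Prop. 3.7 and its proof (bib key `ConnesConsani2021QuasiInner`).
-/

noncomputable section

open _root_.MeasureTheory _root_.Complex AddCircle Filter Set Metric
open scoped Real NNReal ENNReal InnerProductSpace Topology ComplexConjugate

namespace Literature.NumberTheory.ConnesConsani2021

namespace QuasiInner

/-! ### §D. `B_p` on the circle: almost-everywhere limit of the finite products, `L^∞` class -/

/-- The symmetric partial product is the finite Blaschke product over the set `{x_p(n) : |n| ≤ N}`. [folklore] -/
private theorem bl_prod_image {p : ℕ} (hp : 1 < p) (N : ℕ) (v : ℂ) :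
    ∏ α ∈ (Finset.Icc (-(N : ℤ)) N).image (xPrime p), blaschkeFactor α v =
      ∏ n ∈ Finset.Icc (-(N : ℤ)) N, blaschkeFactor (xPrime p n) v :=
  Finset.prod_image fun _ _ _ _ h => xPrime_injective hp h

/-- The zeros `x_p(n)`, `|n| ≤ N`, lie in the open disc and are nonzero. [folklore] -/
private theorem bl_image_hyp {p : ℕ} (hp : 1 < p) (N : ℕ) :
    ∀ α ∈ (Finset.Icc (-(N : ℤ)) N).image (xPrime p), ‖α‖ < 1 ∧ α ≠ 0 := by
  intro α hα
  obtain ⟨n, -, rfl⟩ := Finset.mem_image.1 hα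
  exact ⟨norm_xPrime_lt_one hp n, xPrime_ne_zero hp n⟩

/-- Almost every point of the circle is not the point `1` (`x = 0`). [folklore] -/
private theorem bl_ae_ne_zero : ∀ᵐ x : AddCircle (1:ℝ) ∂haarAddCircle, x ≠ 0 := by
  have hvol : (volume : Measure (AddCircle (1:ℝ))) = haarAddCircle := by
    rw [AddCircle.volume_eq_smul_haarAddCircle, ENNReal.ofReal_one, one_smul]
  have h0 : (haarAddCircle : Measure (AddCircle (1:ℝ))) {0} = 0 := by
    rw [← hvol, ← Metric.closedBall_zero, AddCircle.volume_closedBall]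
    simp
  have h1 : ({0} : Set (AddCircle (1:ℝ)))ᶜ ∈ ae (haarAddCircle : Measure (AddCircle (1:ℝ))) :=
    compl_mem_ae_iff.2 h0
  filter_upwards [h1] with x hx
  exact hx

/-- For `x ≠ 0` on `ℝ/ℤ`, `e^{2πix} ≠ 1`. [folklore] -/
private theorem bl_toCircle_ne_one {x : AddCircle (1:ℝ)} (hx : x ≠ 0) : ((toCircle x : Circle) : ℂ) ≠ 1 := by
  intro h
  apply hx
  apply AddCircle.injective_toCircle one_ne_zero
  rw [AddCircle.toCircle_zero]
  exact Circle.ext h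

/-- RH-FREE. On the circle, the finite Blaschke products converge almost everywhere to `B_p`.
[cite: ConnesConsani2021QuasiInner, Prop 3.7 (ii), proof (arXiv chunk p0009:L61–p0010:L7)] -/
theorem ae_tendsto_blaschkeProd_blaschkePrime {p : ℕ} (hp : 1 < p) :
    ∀ᵐ x : AddCircle (1:ℝ) ∂haarAddCircle,
      Tendsto (fun N : ℕ => circleRestrict 1 (fun v => ∏ α ∈ (Finset.Icc (-(N : ℤ)) N).image (xPrime p),
        blaschkeFactor α v) x) atTop (𝓝 (circleRestrict 1 (blaschkePrime p) x)) := by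
  filter_upwards [bl_ae_ne_zero] with x hx
  simp only [circleRestrict, bl_prod_image hp]
  exact tendsto_prod_Icc_blaschkeFactor hp (le_of_eq (Circle.norm_coe _)) (bl_toCircle_ne_one hx)

/-- RH-FREE. `|B_p| = 1` almost everywhere on `S¹`.
[cite: ConnesConsani2021QuasiInner, Prop 3.7 (ii), proof (arXiv chunk p0009:L61–p0010:L7)] -/
theorem ae_norm_circleRestrict_blaschkePrime {p : ℕ} (hp : 1 < p) :
    ∀ᵐ x : AddCircle (1:ℝ) ∂haarAddCircle, ‖circleRestrict 1 (blaschkePrime p) x‖ = 1 := by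
  filter_upwards [bl_ae_ne_zero] with x hx
  exact norm_blaschkePrime_eq_one hp (Circle.norm_coe _) (bl_toCircle_ne_one hx)

/-- RH-FREE. `B_p|_{S¹} ∈ L^∞(S¹)` («`B_p(v)` is … of modulus `1` on `S¹`, bounded holomorphic in `𝒰`»).
[cite: ConnesConsani2021QuasiInner, Prop 3.7 (ii), proof (arXiv chunk p0010:L1–L7)] -/
theorem memLp_circleRestrict_blaschkePrime {p : ℕ} (hp : 1 < p) :
    MemLp (circleRestrict 1 (blaschkePrime p)) ∞ (haarAddCircle (T := (1:ℝ))) := by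
  refine memLp_top_of_bound ?_ 1 ?_
  · refine aestronglyMeasurable_of_tendsto_ae atTop (fun N => ?_) (ae_tendsto_blaschkeProd_blaschkePrime hp)
    exact (continuous_circleRestrict_blaschkeProd _ fun α hα => (bl_image_hyp hp N α hα).1).aestronglyMeasurable
  · filter_upwards [ae_norm_circleRestrict_blaschkePrime hp] with x hx
    exact hx.le

/-- RH-FREE. The conjugate boundary function `B̄_p|_{S¹} ∈ L^∞(S¹)`. [cite: ConnesConsani2021QuasiInner, Prop 3.7 (ii), proof (arXiv chunk p0010:L1–L7)] -/
theorem memLp_conj_circleRestrict_blaschkePrime {p : ℕ} (hp : 1 < p) :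
    MemLp (fun x => conj (circleRestrict 1 (blaschkePrime p) x)) ∞ (haarAddCircle (T := (1:ℝ))) := by
  refine memLp_top_of_bound
    (Complex.continuous_conj.comp_aestronglyMeasurable (memLp_circleRestrict_blaschkePrime hp).1) 1 ?_
  filter_upwards [ae_norm_circleRestrict_blaschkePrime hp] with x hx
  rw [RCLike.norm_conj]
  exact hx.le

/-! ### §E. Passing to the limit: `ker((1 − 𝒫)ρ(u_p)𝒫) ∩ H² = B_p H²` -/

/-- Dominated convergence for multiplication operators, weak form: if `|u_N| ≤ 1` and `u_N → u` a.e. then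
`⟨φ | u_N g⟩ → ⟨φ | u g⟩` for all `φ, g ∈ L²`. [folklore] -/
private theorem bl_tendsto_inner_mulOp {uN : ℕ → Lp ℂ ∞ (haarAddCircle (T := (1:ℝ)))}
    {u : Lp ℂ ∞ (haarAddCircle (T := (1:ℝ)))}
    (hb : ∀ N, ∀ᵐ x ∂haarAddCircle, ‖uN N x‖ ≤ 1)
    (hlim : ∀ᵐ x ∂haarAddCircle, Tendsto (fun N => uN N x) atTop (𝓝 (u x)))
    (φ g : Lp ℂ 2 (haarAddCircle (T := (1:ℝ)))) :
    Tendsto (fun N => ⟪φ, mulOp haarAddCircle (uN N) g⟫_ℂ) atTop (𝓝 ⟪φ, mulOp haarAddCircle u g⟫_ℂ) := by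
  have e : ∀ w : Lp ℂ ∞ (haarAddCircle (T := (1:ℝ))),
      ⟪φ, mulOp haarAddCircle w g⟫_ℂ = ∫ x, (w x * g x) * conj (φ x) ∂haarAddCircle := by
    intro w
    rw [MeasureTheory.L2.inner_def]
    refine integral_congr_ae ?_
    filter_upwards [coeFn_mulOp haarAddCircle w g] with x hx
    rw [hx, RCLike.inner_apply]
  simp_rw [e]
  refine tendsto_integral_of_dominated_convergence (fun x => ‖g x‖ ^ 2 + ‖φ x‖ ^ 2) (fun N => ?_) ?_
    (fun N => ?_) ?_
  · exact ((Lp.aestronglyMeasurable _).mul (Lp.aestronglyMeasurable g)).mul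
      (Complex.continuous_conj.comp_aestronglyMeasurable (Lp.aestronglyMeasurable φ))
  · exact ((memLp_two_iff_integrable_sq_norm (Lp.aestronglyMeasurable g)).1 (Lp.memLp g)).add
      ((memLp_two_iff_integrable_sq_norm (Lp.aestronglyMeasurable φ)).1 (Lp.memLp φ))
  · filter_upwards [hb N] with x hx
    rw [norm_mul, norm_mul, RCLike.norm_conj]
    have hg0 := norm_nonneg (g x)
    have hφ0 := norm_nonneg (φ x)
    calc ‖uN N x‖ * ‖g x‖ * ‖φ x‖ ≤ 1 * ‖g x‖ * ‖φ x‖ := by gcongr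
      _ ≤ ‖g x‖ ^ 2 + ‖φ x‖ ^ 2 := by nlinarith [sq_nonneg (‖g x‖ - ‖φ x‖)]
  · filter_upwards [hlim] with x hx
    exact (hx.mul tendsto_const_nhds).mul tendsto_const_nhds

/-- RH-FREE. **Prop 3.7 (ii)**: the kernel of `(1 − 𝒫)ρ(u_p)𝒫` restricted to `H²(𝒰)` is `𝒫 B_p 𝒫 (L²) = B_p H²`
(«by a Theorem of F. Riesz, all such functions are of the form `𝒫B𝒫 h`»; here: F. Riesz division by the finite
products `B_N = ∏_{|n|≤N} b_{x_p(n)}` and `N → ∞` by dominated convergence, `|B_N| ≤ 1`, `B_N → B_p` a.e. on `S¹`).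
[cite: ConnesConsani2021QuasiInner, Prop 3.7 (ii) «Blaschke» (arXiv chunk p0009:L46–L53, proof p0010:L1–L7)] -/
theorem prop_3_7_ii {p : ℕ} (hp : p.Prime) :
    LinearMap.ker (hardyOffDiag 1 (toLpOrZero ∞ haarAddCircle (circleRestrict 1 (kappaPrime p)))).toLinearMap
        ⊓ hardySpace 1 =
      Submodule.map
        (mulOp haarAddCircle (toLpOrZero ∞ haarAddCircle (circleRestrict 1 (blaschkePrime p)))).toLinearMap
        (hardySpace 1) := by
  have hp1 := hp.one_lt
  -- the multiplier `u = B_p|_{S¹}` and its conjugate, as `L^∞` classes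
  set u := toLpOrZero ∞ haarAddCircle (circleRestrict 1 (blaschkePrime p)) with hu
  have hucoe : (u : AddCircle (1:ℝ) → ℂ) =ᵐ[haarAddCircle] circleRestrict 1 (blaschkePrime p) := by
    rw [hu, toLpOrZero_eq_toLp (memLp_circleRestrict_blaschkePrime hp1)]
    exact MemLp.coeFn_toLp _
  set ubar := toLpOrZero ∞ haarAddCircle (fun x => conj (circleRestrict 1 (blaschkePrime p) x)) with hubar
  have hubarcoe : (ubar : AddCircle (1:ℝ) → ℂ) =ᵐ[haarAddCircle]
      fun x => conj (circleRestrict 1 (blaschkePrime p) x) := by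
    rw [hubar, toLpOrZero_eq_toLp (memLp_conj_circleRestrict_blaschkePrime hp1)]
    exact MemLp.coeFn_toLp _
  -- the finite products `B_N`, as continuous functions on the circle
  set s : ℕ → Finset ℂ := fun N => (Finset.Icc (-(N : ℤ)) N).image (xPrime p) with hs
  have hs1 : ∀ N, ∀ α ∈ s N, ‖α‖ < 1 := fun N α hα => (bl_image_hyp hp1 N α hα).1
  have hs2 : ∀ N, ∀ α ∈ s N, ‖α‖ < 1 ∧ α ≠ 0 := fun N => bl_image_hyp hp1 N
  set P : ℕ → C(AddCircle (1:ℝ), ℂ) := fun N =>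
    ⟨circleRestrict 1 fun v => ∏ α ∈ s N, blaschkeFactor α v,
      continuous_circleRestrict_blaschkeProd (s N) (hs1 N)⟩ with hP
  set uN : ℕ → Lp ℂ ∞ (haarAddCircle (T := (1:ℝ))) := fun N =>
    ContinuousMap.toLp (E := ℂ) ∞ haarAddCircle ℂ (P N) with huN
  set uNbar : ℕ → Lp ℂ ∞ (haarAddCircle (T := (1:ℝ))) := fun N =>
    ContinuousMap.toLp (E := ℂ) ∞ haarAddCircle ℂ (star (P N)) with huNbar
  have hPcoe : ∀ᵐ x ∂haarAddCircle, ∀ N, (uN N : AddCircle (1:ℝ) → ℂ) x = P N x :=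
    ae_all_iff.2 fun N => ContinuousMap.coeFn_toLp (p := ∞) (𝕜 := ℂ) haarAddCircle (P N)
  have hPbarcoe : ∀ᵐ x ∂haarAddCircle, ∀ N, (uNbar N : AddCircle (1:ℝ) → ℂ) x = star (P N) x :=
    ae_all_iff.2 fun N => ContinuousMap.coeFn_toLp (p := ∞) (𝕜 := ℂ) haarAddCircle (star (P N))
  have hPx : ∀ N x, P N x = ∏ α ∈ s N, blaschkeFactor α (toCircle x : ℂ) := fun N x => rfl
  -- a.e. convergence and bounds
  have hlimP : ∀ᵐ x ∂haarAddCircle, Tendsto (fun N => (uN N : AddCircle (1:ℝ) → ℂ) x) atTop (𝓝 (u x)) := by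
    filter_upwards [hPcoe, hucoe, ae_tendsto_blaschkeProd_blaschkePrime hp1] with x h1 h2 h3
    simp only [h1, h2]
    exact h3
  have hlimPbar : ∀ᵐ x ∂haarAddCircle,
      Tendsto (fun N => (uNbar N : AddCircle (1:ℝ) → ℂ) x) atTop (𝓝 (ubar x)) := by
    filter_upwards [hPbarcoe, hubarcoe, ae_tendsto_blaschkeProd_blaschkePrime hp1] with x h1 h2 h3
    simp only [h1, h2, ContinuousMap.star_apply, Complex.star_def]
    exact (Complex.continuous_conj.tendsto _).comp h3
  have hbP : ∀ N, ∀ᵐ x ∂haarAddCircle, ‖(uN N : AddCircle (1:ℝ) → ℂ) x‖ ≤ 1 := fun N => by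
    filter_upwards [hPcoe] with x h1
    rw [h1 N, hPx]
    exact le_of_eq (norm_blaschkeProd_of_norm_eq_one (s N) (hs2 N) (Circle.norm_coe _))
  have hbPbar : ∀ N, ∀ᵐ x ∂haarAddCircle, ‖(uNbar N : AddCircle (1:ℝ) → ℂ) x‖ ≤ 1 := fun N => by
    filter_upwards [hPbarcoe] with x h1
    rw [h1 N, ContinuousMap.star_apply, norm_star, hPx]
    exact le_of_eq (norm_blaschkeProd_of_norm_eq_one (s N) (hs2 N) (Circle.norm_coe _))
  apply le_antisymm
  · -- `K ∩ H² ≤ B_p H²`: divide by `B_N`, let `N → ∞`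
    intro f hf
    obtain ⟨hfH, hfz⟩ := (mem_ker_hardyOffDiag_kappaPrime_inf_hardySpace_iff hp f).1 hf
    rw [Submodule.mem_map]
    refine ⟨mulOp haarAddCircle ubar f, ?_, ?_⟩
    · rw [mem_hardySpace_iff]
      intro m
      have hN : ∀ N, ⟪fourierLp (T := (1:ℝ)) 2 (-(m + 1 : ℤ)), mulOp haarAddCircle (uNbar N) f⟫_ℂ = 0 :=
        fun N => (mem_hardySpace_iff 1 _).1 (mulOp_star_blaschkeProd_mem_hardySpace (s N) (hs2 N) hfH
          (fun α hα => by obtain ⟨n, -, rfl⟩ := Finset.mem_image.1 hα; exact hfz n)).1 m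
      have hlim := bl_tendsto_inner_mulOp hbPbar hlimPbar (fourierLp (T := (1:ℝ)) 2 (-(m + 1 : ℤ))) f
      simp only [hN] at hlim
      exact (tendsto_nhds_unique tendsto_const_nhds hlim).symm
    · rw [ContinuousLinearMap.coe_coe]
      apply Lp.ext
      filter_upwards [coeFn_mulOp haarAddCircle u (mulOp haarAddCircle ubar f),
        coeFn_mulOp haarAddCircle ubar f, hucoe, hubarcoe, ae_norm_circleRestrict_blaschkePrime hp1]
        with x h1 h2 h3 h4 h5
      rw [h1, h2, h3, h4, ← mul_assoc, Complex.mul_conj, Complex.normSq_eq_norm_sq, h5]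
      simp
  · -- `B_p H² ≤ K ∩ H²`: `B_N h ∈ H²` vanishes at the `x_p(n)`, `|n| ≤ N`; let `N → ∞`
    intro g hg
    rw [Submodule.mem_map] at hg
    obtain ⟨h, hh, rfl⟩ := hg
    rw [ContinuousLinearMap.coe_coe]
    have hgN := fun N => mulOp_blaschkeProd_mem_hardySpace (s N) (hs1 N) hh
    refine (mem_ker_hardyOffDiag_kappaPrime_inf_hardySpace_iff hp _).2 ⟨?_, fun n => ?_⟩
    · rw [mem_hardySpace_iff]
      intro m
      have hlim := bl_tendsto_inner_mulOp hbP hlimP (fourierLp (T := (1:ℝ)) 2 (-(m + 1 : ℤ))) h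
      have hN : ∀ N, ⟪fourierLp (T := (1:ℝ)) 2 (-(m + 1 : ℤ)), mulOp haarAddCircle (uN N) h⟫_ℂ = 0 :=
        fun N => (mem_hardySpace_iff 1 _).1 (hgN N).1 m
      simp only [hN] at hlim
      exact (tendsto_nhds_unique tendsto_const_nhds hlim).symm
    · have hlim := bl_tendsto_inner_mulOp hbP hlimP (etaVec 1 (xPrime p n)) h
      have hev : ∀ᶠ N in atTop, (0 : ℂ) = ⟪etaVec 1 (xPrime p n), mulOp haarAddCircle (uN N) h⟫_ℂ := by
        filter_upwards [eventually_ge_atTop n.natAbs] with N hN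
        rw [(hgN N).2 (xPrime p n) (norm_xPrime_lt_one hp1 n)]
        have hmem : xPrime p n ∈ s N :=
          Finset.mem_image.2 ⟨n, by simp only [Finset.mem_Icc]; omega, rfl⟩
        rw [Finset.prod_eq_zero (f := fun α => blaschkeFactor α (xPrime p n)) hmem (blaschkeFactor_self _),
          zero_mul]
      have h0 : Tendsto (fun N => ⟪etaVec 1 (xPrime p n), mulOp haarAddCircle (uN N) h⟫_ℂ) atTop (𝓝 0) :=
        tendsto_const_nhds.congr' hev
      exact tendsto_nhds_unique hlim h0

end QuasiInner

end Literature.NumberTheory.ConnesConsani2021
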